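import Summits.QuantumFields.YangMills.Theorems.CovariantDischargeAvgPlaqCharge
import HarnessLib

/-!
# Line «sandwich_discharge» on crux `HistoryTailL` (stmt-QuantumFields-19936), stub `stub_sandwichSweepGapCapped` (S′), bricks B4 ∕ (B5-d) —
# (Z-e) FILE 7 «THE DIPOLE-MATCHED PAIR»: `ω := ω_p(· − δ) − ((L^j)²∕(L^h)²)·ω_{P″}` in the chart of the COARSER block's corner — support, antisymmetry,
# componentwise mean ZERO, the masses, the height, and the two-height pairing identity: the data FILE 4∕5 quantify over, INHABITED

Cell `ym3-torus` (YM ladder rung R3 = continuum SU(2) Yang–Mills on the three-torus — a RUNG, NOT the Clay problem: not d = 4, not infinite volume,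
not a mass gap); width seat `ym3-torus-px8` gen 7; `--supports stmt-QuantumFields-19936` (helper).  THEOREMS ONLY (0 `def`, default heartbeats); generic
`P : Params`, levels `j ≤ h ≤ m + K`; the letters of FILE 6 ✓`CovariantDischargeAvgPlaqCharge` (corner charts, one-stroke sums, counting charges as free symbols).

THE OBJECTS (px8 g6 ARCH-S′ §3 «kill the dipole»).  Level-`j` site `y` (= `p.src`) inside the level-`h` site `Y` (= `P″.src`): `hnest : val(y_i) ∕ L^{h−j} = val(Y_i)`;
corners `c` (`val = val(y)·L^j`), `C` (`val = val(Y)·L^h`); OFFSET `δ_i := val(y_i)·L^j − val(Y_i)·L^h ∈ [0, L^h − L^j]` (`transl C δ = c`); the counting charges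
`ω_j`, `ω_h` of FILE 6 (free symbols `Nj`, `Nh` for the two fibre counts, directions `μ ≠ ν`); the MATCHED charge `ω(w,a,b) := ω_j(w − δ,a,b) − ρ·ω_h(w,a,b)`,
`ρ := (L^j)²∕(L^h)²` (the dipole-moment ratio).
* §1 `offset_nonneg`, `offset_le`, `transl_corner_offset` (`transl C δ = c`), `transl_offset_add` (`transl C (w) = transl c (w − δ)`).
* §2 `matched_anti`, ★`matched_eq_zero_off_box` (support `box 0 (2L^h)`), ★★`sum_matched_eq_zero` (COMPONENTWISE MEAN ZERO).
* §3 ★`sum_abs_matched_le` (`Σ_{ab}Σ_{box 0 ℓ′}|ω| ≤ 2(L^j)²·κ_j♯ + 2ρ(L^h)²·κ_h♯` with `κ_k♯ := ((L^d)^k)⁻¹·(L^k)^d = 1`-free closed form `2·κ_j(L^j)^d(L^j)² + 2ρ·κ_h(L^h)^d(L^h)²`),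
  ★`abs_matched_le` (height), `firstMoment_matched_le` (`M₁ ≤ d·(2L^h)·M₀` on `box 0 (2L^h)`).
* §4 ★★`sum_matched_mul_eq` — THE TWO-HEIGHT PAIRING against an antisymmetric torus reading `Φ` in the `C`-chart.
* §5 ★★★`matched_counting_data` — the COUNTING charges of FILE 6 with `ρ := (L^j)²∕(L^h)²` INHABIT FILE 4∕5's three hypotheses (support, antisymmetry,
  componentwise mean zero) with the ℓ¹ mass and the height in closed form.
HONEST SCOPE: finite combinatorics; NOTHING here proves B4's `θ`-arithmetic, B6, the capped stub, `HistoryTailL`, or any summit statement; YM₃ on T³ is rung R3,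
not Clay. [folklore]
-/

noncomputable section

open scoped BigOperators
open Finset

namespace Summit.QuantumFields.YangMills.Theorems.CovariantDischargeMatchedPairCharge

open Literature.MathematicalPhysics.QuantumFieldTheory.Balaban1983to89
open Literature.MathematicalPhysics.QuantumFieldTheory.Balaban1983to89.B4Eq19LatticeOperators (Zd box mem_box unitVec box_mono sum_box_add_right)
open B5Eq118OneStroke (iterBlock)
open LatticeFieldCalculus (runSite)
open B10Eq27TorusAxialLog (transl transl_apply transl_add)
open Summit.QuantumFields.YangMills.Theorems.CovariantDischargeAvgPlaqCharge (charge_anti sum_sum_charge_mul count_eq_zero_off_box sum_count_eq count_le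
  sum_charge_mul_eq_oneStroke)

variable {P : Params} {j h : ℕ}

/-! ## §1 The offset between the two corners -/

/-- `0 ≤ δ_i`. [folklore] -/
theorem offset_nonneg (hjh : j ≤ h) (y : Site P j) (Y : Site P h) (hnest : ∀ i, (y i).val / P.L ^ (h - j) = (Y i).val) (i : Fin P.d) :
    (0 : ℤ) ≤ ((y i).val : ℤ) * (P.L : ℤ) ^ j - ((Y i).val : ℤ) * (P.L : ℤ) ^ h := by
  have h1 : (Y i).val * P.L ^ (h - j) ≤ (y i).val := by rw [← hnest i]; exact Nat.div_mul_le_self _ _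
  have h2 : (Y i).val * P.L ^ h ≤ (y i).val * P.L ^ j := by
    calc (Y i).val * P.L ^ h = (Y i).val * P.L ^ (h - j) * P.L ^ j := by rw [mul_assoc, ← pow_add, Nat.sub_add_cancel hjh]
      _ ≤ (y i).val * P.L ^ j := Nat.mul_le_mul_right _ h1
  have : ((Y i).val : ℤ) * (P.L : ℤ) ^ h ≤ ((y i).val : ℤ) * (P.L : ℤ) ^ j := by exact_mod_cast h2
  linarith

/-- `δ_i ≤ L^h − L^j`. [folklore] -/
theorem offset_le (hjh : j ≤ h) (y : Site P j) (Y : Site P h) (hnest : ∀ i, (y i).val / P.L ^ (h - j) = (Y i).val) (i : Fin P.d) :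
    ((y i).val : ℤ) * (P.L : ℤ) ^ j - ((Y i).val : ℤ) * (P.L : ℤ) ^ h ≤ (P.L : ℤ) ^ h - (P.L : ℤ) ^ j := by
  have hL : 0 < P.L ^ (h - j) := pow_pos P.L_pos _
  have h1 : (y i).val + 1 ≤ ((Y i).val + 1) * P.L ^ (h - j) := by
    have hd := Nat.div_add_mod ((y i).val) (P.L ^ (h - j))
    have hm := Nat.mod_lt ((y i).val) hL
    rw [hnest i, mul_comm] at hd
    rw [Nat.add_mul, one_mul]
    omega
  have h2 : ((y i).val + 1) * P.L ^ j ≤ ((Y i).val + 1) * P.L ^ h := by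
    calc ((y i).val + 1) * P.L ^ j ≤ ((Y i).val + 1) * P.L ^ (h - j) * P.L ^ j := Nat.mul_le_mul_right _ h1
      _ = ((Y i).val + 1) * P.L ^ h := by rw [mul_assoc, ← pow_add, Nat.sub_add_cancel hjh]
  have : (((y i).val : ℤ) + 1) * (P.L : ℤ) ^ j ≤ (((Y i).val : ℤ) + 1) * (P.L : ℤ) ^ h := by exact_mod_cast h2
  nlinarith

/-- `transl C δ = c`: the fine corner is the coarse corner translated by the offset. [folklore] -/
theorem transl_corner_offset (y : Site P j) (Y : Site P h) (c C : Site P 0)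
    (hc : ∀ i, (c i).val = (y i).val * P.L ^ j) (hC : ∀ i, (C i).val = (Y i).val * P.L ^ h) (δ : Zd P.d)
    (hδ : ∀ i, δ i = ((y i).val : ℤ) * (P.L : ℤ) ^ j - ((Y i).val : ℤ) * (P.L : ℤ) ^ h) : transl C δ = c := by
  funext i
  rw [transl_apply, hδ]
  have e1 : (C i : ZMod (P.sitesPerDir 0)) = (((C i).val : ℕ) : ZMod (P.sitesPerDir 0)) := by
    haveI : NeZero (P.sitesPerDir 0) := ⟨P.sitesPerDir_ne_zero 0⟩
    rw [ZMod.natCast_zmod_val]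
  have e2 : (c i : ZMod (P.sitesPerDir 0)) = (((c i).val : ℕ) : ZMod (P.sitesPerDir 0)) := by
    haveI : NeZero (P.sitesPerDir 0) := ⟨P.sitesPerDir_ne_zero 0⟩
    rw [ZMod.natCast_zmod_val]
  rw [e1, e2, hc, hC]
  push_cast
  ring

/-- `transl c w = transl C (δ + w)`. [folklore] -/
theorem transl_offset_add (y : Site P j) (Y : Site P h) (c C : Site P 0)
    (hc : ∀ i, (c i).val = (y i).val * P.L ^ j) (hC : ∀ i, (C i).val = (Y i).val * P.L ^ h) (δ : Zd P.d)
    (hδ : ∀ i, δ i = ((y i).val : ℤ) * (P.L : ℤ) ^ j - ((Y i).val : ℤ) * (P.L : ℤ) ^ h) (w : Zd P.d) :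
    transl c w = transl C (δ + w) := by
  rw [transl_add, transl_corner_offset y Y c C hc hC δ hδ]

/-! ## §2 The matched charge: antisymmetry, support, mean zero -/

section Matched

variable {μ ν : Fin P.d} (κj κh ρ : ℝ) (Nj Nh : Zd P.d → ℝ) (ωj ωh ω : Zd P.d → Fin P.d → Fin P.d → ℝ) (δ : Zd P.d)

/-- The matched charge is antisymmetric. [folklore] -/
theorem matched_anti
    (hωj : ∀ w a b, ωj w a b = κj * Nj w * ((if a = μ ∧ b = ν then 1 else 0) - (if a = ν ∧ b = μ then 1 else 0)))
    (hωh : ∀ w a b, ωh w a b = κh * Nh w * ((if a = μ ∧ b = ν then 1 else 0) - (if a = ν ∧ b = μ then 1 else 0)))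
    (hω : ∀ w a b, ω w a b = ωj (w - δ) a b - ρ * ωh w a b) (w : Zd P.d) (a b : Fin P.d) : ω w b a = -ω w a b := by
  rw [hω, hω, charge_anti μ ν κj Nj ωj hωj, charge_anti μ ν κh Nh ωh hωh]; ring

/-- ★ **SUPPORT**: if `Nj` vanishes off `box 0 (2L^j)`, `Nh` off `box 0 (2L^h)`, and `0 ≤ δ_i ≤ L^h − L^j`, the matched charge vanishes off `box 0 (2L^h)`. [folklore] -/
theorem matched_eq_zero_off_box (hjh : j ≤ h)
    (hωj : ∀ w a b, ωj w a b = κj * Nj w * ((if a = μ ∧ b = ν then 1 else 0) - (if a = ν ∧ b = μ then 1 else 0)))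
    (hωh : ∀ w a b, ωh w a b = κh * Nh w * ((if a = μ ∧ b = ν then 1 else 0) - (if a = ν ∧ b = μ then 1 else 0)))
    (hω : ∀ w a b, ω w a b = ωj (w - δ) a b - ρ * ωh w a b)
    (hNj : ∀ w, w ∉ box (0 : Zd P.d) (2 * (P.L : ℤ) ^ j) → Nj w = 0) (hNh : ∀ w, w ∉ box (0 : Zd P.d) (2 * (P.L : ℤ) ^ h) → Nh w = 0)
    (hδ0 : ∀ i, 0 ≤ δ i) (hδ1 : ∀ i, δ i ≤ (P.L : ℤ) ^ h - (P.L : ℤ) ^ j)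
    (w : Zd P.d) (hw : w ∉ box (0 : Zd P.d) (2 * (P.L : ℤ) ^ h)) (a b : Fin P.d) : ω w a b = 0 := by
  have hLj : (1 : ℤ) ≤ (P.L : ℤ) ^ j := by exact_mod_cast Nat.one_le_pow _ _ P.L_pos
  have hLjh : (P.L : ℤ) ^ j ≤ (P.L : ℤ) ^ h := by exact_mod_cast Nat.pow_le_pow_right P.L_pos hjh
  have hwj : w - δ ∉ box (0 : Zd P.d) (2 * (P.L : ℤ) ^ j) := by
    intro hmem
    apply hw
    rw [mem_box] at hmem ⊢
    intro i
    have hi := hmem i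
    simp only [Pi.sub_apply, Pi.zero_apply, sub_zero] at hi ⊢
    rw [abs_le] at hi ⊢
    constructor <;> linarith [hδ0 i, hδ1 i, hi.1, hi.2]
  rw [hω, hωj, hωh, hNj _ hwj, hNh _ hw]; ring

/-- Reindexing a charge sum by the offset: `Σ_{w∈box 0 ℓ′} f(w − δ) = Σ_{w∈box 0 (2L^j)} f(w)` when `f` vanishes off `box 0 (2L^j)` and `2L^j + |δ|_∞ ≤ ℓ′`. [folklore] -/
theorem sum_box_sub_offset_eq (f : Zd P.d → ℝ) (hf : ∀ w, w ∉ box (0 : Zd P.d) (2 * (P.L : ℤ) ^ j) → f w = 0) {ℓ' : ℤ}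
    (hδℓ : ∀ i, |δ i| + 2 * (P.L : ℤ) ^ j ≤ ℓ') :
    ∑ w ∈ box (0 : Zd P.d) ℓ', f (w - δ) = ∑ w ∈ box (0 : Zd P.d) (2 * (P.L : ℤ) ^ j), f w := by
  have h1 : ∑ w ∈ box (0 : Zd P.d) ℓ', f (w - δ) = ∑ w ∈ box ((0 : Zd P.d) + -δ) ℓ', f w := by
    rw [← sum_box_add_right f 0 (-δ) ℓ']
    simp only [sub_eq_add_neg]
  rw [h1]
  symm
  refine Finset.sum_subset ?_ (fun w _ hw => hf w hw)
  intro w hw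
  rw [mem_box] at hw ⊢
  intro i
  have hi := hw i
  simp only [Pi.add_apply, Pi.zero_apply, Pi.neg_apply, zero_add, sub_neg_eq_add, sub_zero] at hi ⊢
  calc |w i + δ i| ≤ |w i| + |δ i| := abs_add_le _ _
    _ ≤ _ := by linarith [hδℓ i]

/-- ★★ **COMPONENTWISE MEAN ZERO** of the matched charge: with the two total counts `Σ Nj = Tj`, `Σ Nh = Th` and the MATCHING CONDITION `κj·Tj = ρ·κh·Th`
(at the counting charges of FILE 6: `L^{2j} = ((L^j)²∕(L^h)²)·L^{2h}`), `Σ_{w∈box 0 ℓ′} ω(w,a,b) = 0` for `2L^h ≤ ℓ′`. [folklore] -/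
theorem sum_matched_eq_zero (hjh : j ≤ h)
    (hωj : ∀ w a b, ωj w a b = κj * Nj w * ((if a = μ ∧ b = ν then 1 else 0) - (if a = ν ∧ b = μ then 1 else 0)))
    (hωh : ∀ w a b, ωh w a b = κh * Nh w * ((if a = μ ∧ b = ν then 1 else 0) - (if a = ν ∧ b = μ then 1 else 0)))
    (hω : ∀ w a b, ω w a b = ωj (w - δ) a b - ρ * ωh w a b)
    (hNj : ∀ w, w ∉ box (0 : Zd P.d) (2 * (P.L : ℤ) ^ j) → Nj w = 0)
    (hδ0 : ∀ i, 0 ≤ δ i) (hδ1 : ∀ i, δ i ≤ (P.L : ℤ) ^ h - (P.L : ℤ) ^ j) {Tj Th : ℝ}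
    (hTj : ∑ w ∈ box (0 : Zd P.d) (2 * (P.L : ℤ) ^ j), Nj w = Tj) {ℓ' : ℤ} (hℓ' : 2 * (P.L : ℤ) ^ h ≤ ℓ')
    (hTh : ∑ w ∈ box (0 : Zd P.d) ℓ', Nh w = Th) (hmatch : κj * Tj = ρ * (κh * Th)) (a b : Fin P.d) :
    ∑ w ∈ box (0 : Zd P.d) ℓ', ω w a b = 0 := by
  have hLj : (1 : ℤ) ≤ (P.L : ℤ) ^ j := by exact_mod_cast Nat.one_le_pow _ _ P.L_pos
  have hLjh : (P.L : ℤ) ^ j ≤ (P.L : ℤ) ^ h := by exact_mod_cast Nat.pow_le_pow_right P.L_pos hjh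
  have hδℓ : ∀ i, |δ i| + 2 * (P.L : ℤ) ^ j ≤ ℓ' := fun i => by
    rw [abs_of_nonneg (hδ0 i)]; linarith [hδ1 i]
  simp only [hω, Finset.sum_sub_distrib, ← Finset.mul_sum]
  rw [sum_box_sub_offset_eq δ (fun w => ωj w a b) (fun w hw => by rw [hωj, hNj w hw]; ring) hδℓ]
  simp only [hωj, hωh]
  rw [show ∑ x ∈ box (0 : Zd P.d) (2 * (P.L : ℤ) ^ j), κj * Nj x * ((if a = μ ∧ b = ν then (1 : ℝ) else 0) - if a = ν ∧ b = μ then 1 else 0)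
      = κj * (∑ x ∈ box (0 : Zd P.d) (2 * (P.L : ℤ) ^ j), Nj x) * ((if a = μ ∧ b = ν then (1 : ℝ) else 0) - if a = ν ∧ b = μ then 1 else 0) by
    rw [Finset.mul_sum, Finset.sum_mul]]
  rw [show ∑ x ∈ box (0 : Zd P.d) ℓ', κh * Nh x * ((if a = μ ∧ b = ν then (1 : ℝ) else 0) - if a = ν ∧ b = μ then 1 else 0)
      = κh * (∑ x ∈ box (0 : Zd P.d) ℓ', Nh x) * ((if a = μ ∧ b = ν then (1 : ℝ) else 0) - if a = ν ∧ b = μ then 1 else 0) by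
    rw [Finset.mul_sum, Finset.sum_mul]]
  rw [hTj, hTh]
  have : κj * Tj * ((if a = μ ∧ b = ν then (1 : ℝ) else 0) - if a = ν ∧ b = μ then 1 else 0)
      = ρ * (κh * Th * ((if a = μ ∧ b = ν then (1 : ℝ) else 0) - if a = ν ∧ b = μ then 1 else 0)) := by
    rw [← mul_assoc ρ, ← hmatch]
  rw [this, sub_self]

/-! ## §3 Masses -/

/-- ★ **THE ℓ¹ MASS**: `Σ_{ab} Σ_{w∈box 0 ℓ′} |ω(w,a,b)| ≤ 2|κj|·Tj + 2|ρ|·|κh|·Th` (`Nj, Nh ≥ 0`). [folklore] -/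
theorem sum_abs_matched_le (hjh : j ≤ h)
    (hωj : ∀ w a b, ωj w a b = κj * Nj w * ((if a = μ ∧ b = ν then 1 else 0) - (if a = ν ∧ b = μ then 1 else 0)))
    (hωh : ∀ w a b, ωh w a b = κh * Nh w * ((if a = μ ∧ b = ν then 1 else 0) - (if a = ν ∧ b = μ then 1 else 0)))
    (hω : ∀ w a b, ω w a b = ωj (w - δ) a b - ρ * ωh w a b) (hμν : μ ≠ ν)
    (hNj : ∀ w, w ∉ box (0 : Zd P.d) (2 * (P.L : ℤ) ^ j) → Nj w = 0) (hNj0 : ∀ w, 0 ≤ Nj w) (hNh0 : ∀ w, 0 ≤ Nh w)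
    (hδ0 : ∀ i, 0 ≤ δ i) (hδ1 : ∀ i, δ i ≤ (P.L : ℤ) ^ h - (P.L : ℤ) ^ j) {Tj Th : ℝ}
    (hTj : ∑ w ∈ box (0 : Zd P.d) (2 * (P.L : ℤ) ^ j), Nj w = Tj) {ℓ' : ℤ} (hℓ' : 2 * (P.L : ℤ) ^ h ≤ ℓ')
    (hTh : ∑ w ∈ box (0 : Zd P.d) ℓ', Nh w = Th) :
    ∑ a, ∑ b, ∑ w ∈ box (0 : Zd P.d) ℓ', |ω w a b| ≤ 2 * (|κj| * Tj) + 2 * (|ρ| * (|κh| * Th)) := by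
  have hLj : (1 : ℤ) ≤ (P.L : ℤ) ^ j := by exact_mod_cast Nat.one_le_pow _ _ P.L_pos
  have hLjh : (P.L : ℤ) ^ j ≤ (P.L : ℤ) ^ h := by exact_mod_cast Nat.pow_le_pow_right P.L_pos hjh
  have hδℓ : ∀ i, |δ i| + 2 * (P.L : ℤ) ^ j ≤ ℓ' := fun i => by
    rw [abs_of_nonneg (hδ0 i)]; linarith [hδ1 i]
  -- the indicator pattern: `|[a=μ∧b=ν] − [a=ν∧b=μ]|` summed over `(a,b)` is `2`
  have hind : ∀ (X : ℝ), 0 ≤ X →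
      ∑ a : Fin P.d, ∑ b : Fin P.d, X * |((if a = μ ∧ b = ν then (1 : ℝ) else 0) - if a = ν ∧ b = μ then 1 else 0)| = 2 * X := by
    intro X hX
    have hval : ∀ a b : Fin P.d, |((if a = μ ∧ b = ν then (1 : ℝ) else 0) - if a = ν ∧ b = μ then 1 else 0)|
        = (if a = μ ∧ b = ν then (1 : ℝ) else 0) + (if a = ν ∧ b = μ then 1 else 0) := by
      intro a b
      by_cases h1 : a = μ ∧ b = ν
      · have h2 : ¬ (a = ν ∧ b = μ) := fun h2 => hμν (h1.1.symm.trans h2.1)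
        rw [if_pos h1, if_neg h2]; norm_num
      · by_cases h2 : a = ν ∧ b = μ
        · rw [if_neg h1, if_pos h2]; norm_num
        · rw [if_neg h1, if_neg h2]; norm_num
    simp only [hval, mul_add, Finset.sum_add_distrib, ← Finset.mul_sum]
    have hA : ∑ a : Fin P.d, ∑ b : Fin P.d, (if a = μ ∧ b = ν then (1 : ℝ) else 0) = 1 := by
      rw [Finset.sum_eq_single μ (fun a _ ha => by simp [ha]) (fun hh => (hh (Finset.mem_univ _)).elim)]
      rw [Finset.sum_eq_single ν (fun b _ hb => by simp [hb]) (fun hh => (hh (Finset.mem_univ _)).elim)]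
      simp
    have hB : ∑ a : Fin P.d, ∑ b : Fin P.d, (if a = ν ∧ b = μ then (1 : ℝ) else 0) = 1 := by
      rw [Finset.sum_eq_single ν (fun a _ ha => by simp [ha]) (fun hh => (hh (Finset.mem_univ _)).elim)]
      rw [Finset.sum_eq_single μ (fun b _ hb => by simp [hb]) (fun hh => (hh (Finset.mem_univ _)).elim)]
      simp
    rw [hA, hB]; ring
  -- termwise triangle inequality, then the two total counts
  have hpt : ∀ w a b, |ω w a b| ≤ |κj| * Nj (w - δ) * |((if a = μ ∧ b = ν then (1 : ℝ) else 0) - if a = ν ∧ b = μ then 1 else 0)|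
      + |ρ| * (|κh| * Nh w) * |((if a = μ ∧ b = ν then (1 : ℝ) else 0) - if a = ν ∧ b = μ then 1 else 0)| := by
    intro w a b
    rw [hω, hωj, hωh]
    refine (abs_sub _ _).trans (le_of_eq ?_)
    rw [abs_mul, abs_mul, abs_mul, abs_mul, abs_mul, abs_of_nonneg (hNj0 _), abs_of_nonneg (hNh0 _)]; ring
  calc ∑ a, ∑ b, ∑ w ∈ box (0 : Zd P.d) ℓ', |ω w a b|
      ≤ ∑ a, ∑ b, ∑ w ∈ box (0 : Zd P.d) ℓ', (|κj| * Nj (w - δ) * |((if a = μ ∧ b = ν then (1 : ℝ) else 0) - if a = ν ∧ b = μ then 1 else 0)|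
          + |ρ| * (|κh| * Nh w) * |((if a = μ ∧ b = ν then (1 : ℝ) else 0) - if a = ν ∧ b = μ then 1 else 0)|) :=
        Finset.sum_le_sum fun a _ => Finset.sum_le_sum fun b _ => Finset.sum_le_sum fun w _ => hpt w a b
    _ = ∑ a, ∑ b, ((|κj| * Tj) * |((if a = μ ∧ b = ν then (1 : ℝ) else 0) - if a = ν ∧ b = μ then 1 else 0)|
          + (|ρ| * (|κh| * Th)) * |((if a = μ ∧ b = ν then (1 : ℝ) else 0) - if a = ν ∧ b = μ then 1 else 0)|) := by
        refine Finset.sum_congr rfl fun a _ => Finset.sum_congr rfl fun b _ => ?_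
        rw [Finset.sum_add_distrib, ← Finset.sum_mul, ← Finset.sum_mul, ← Finset.mul_sum, ← Finset.mul_sum, ← Finset.mul_sum,
          sum_box_sub_offset_eq δ Nj hNj hδℓ, hTj, hTh]
    _ = 2 * (|κj| * Tj) + 2 * (|ρ| * (|κh| * Th)) := by
        rw [Finset.sum_comm]
        simp only [Finset.sum_add_distrib]
        rw [Finset.sum_comm, hind _ (by rw [← hTj]; exact mul_nonneg (abs_nonneg _) (Finset.sum_nonneg fun w _ => hNj0 w)),
          Finset.sum_comm, hind _ (by rw [← hTh]; exact mul_nonneg (abs_nonneg _) (mul_nonneg (abs_nonneg _) (Finset.sum_nonneg fun w _ => hNh0 w)))]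

/-- The height of one counting charge: `|ω₁(w,a,b)| ≤ |κ|·B` when `0 ≤ N ≤ B` pointwise. [folklore] -/
theorem abs_charge_le_of_le (κ : ℝ) (N : Zd P.d → ℝ) (ω₁ : Zd P.d → Fin P.d → Fin P.d → ℝ)
    (hω₁ : ∀ w a b, ω₁ w a b = κ * N w * ((if a = μ ∧ b = ν then 1 else 0) - (if a = ν ∧ b = μ then 1 else 0)))
    (hN0 : ∀ w, 0 ≤ N w) {B : ℝ} (hB : ∀ w, N w ≤ B) (w : Zd P.d) (a b : Fin P.d) : |ω₁ w a b| ≤ |κ| * B := by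
  have hI : |((if a = μ ∧ b = ν then (1 : ℝ) else 0) - if a = ν ∧ b = μ then 1 else 0)| ≤ 1 := by
    split_ifs <;> norm_num
  rw [hω₁, abs_mul, abs_mul, abs_of_nonneg (hN0 w)]
  have hB0 : 0 ≤ B := (hN0 w).trans (hB w)
  calc |κ| * N w * |((if a = μ ∧ b = ν then (1 : ℝ) else 0) - if a = ν ∧ b = μ then 1 else 0)|
      ≤ |κ| * B * 1 := mul_le_mul (mul_le_mul_of_nonneg_left (hB w) (abs_nonneg _)) hI (abs_nonneg _) (mul_nonneg (abs_nonneg _) hB0)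
    _ = |κ| * B := mul_one _

/-- ★ **THE HEIGHT**: `|ω(w,a,b)| ≤ |κj|·Bj + |ρ|·|κh|·Bh` when `0 ≤ Nj ≤ Bj`, `0 ≤ Nh ≤ Bh` pointwise. [folklore] -/
theorem abs_matched_le
    (hωj : ∀ w a b, ωj w a b = κj * Nj w * ((if a = μ ∧ b = ν then 1 else 0) - (if a = ν ∧ b = μ then 1 else 0)))
    (hωh : ∀ w a b, ωh w a b = κh * Nh w * ((if a = μ ∧ b = ν then 1 else 0) - (if a = ν ∧ b = μ then 1 else 0)))
    (hω : ∀ w a b, ω w a b = ωj (w - δ) a b - ρ * ωh w a b) (hNj0 : ∀ w, 0 ≤ Nj w) (hNh0 : ∀ w, 0 ≤ Nh w) {Bj Bh : ℝ}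
    (hBj : ∀ w, Nj w ≤ Bj) (hBh : ∀ w, Nh w ≤ Bh) (w : Zd P.d) (a b : Fin P.d) :
    |ω w a b| ≤ |κj| * Bj + |ρ| * (|κh| * Bh) := by
  rw [hω]
  refine (abs_sub _ _).trans (add_le_add (abs_charge_le_of_le κj Nj ωj hωj hNj0 hBj (w - δ) a b) ?_)
  rw [abs_mul]
  exact mul_le_mul_of_nonneg_left (abs_charge_le_of_le κh Nh ωh hωh hNh0 hBh w a b) (abs_nonneg _)

/-- **THE FIRST MOMENT ON A BOX**: `Σ_{ab}Σ_{w∈box 0 ℓ′} ‖w‖₁·|ω| ≤ (d·ℓ′)·Σ_{ab}Σ_{w∈box 0 ℓ′} |ω|` (any `ℓ′`; the box is empty for `ℓ′ < 0`). [folklore] -/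
theorem firstMoment_le_of_box (f : Zd P.d → Fin P.d → Fin P.d → ℝ) (ℓ' : ℤ) :
    ∑ a, ∑ b, ∑ w ∈ box (0 : Zd P.d) ℓ', (∑ i, |((w i - (0 : Zd P.d) i : ℤ) : ℝ)|) * |f w a b|
      ≤ ((P.d : ℝ) * ℓ') * ∑ a, ∑ b, ∑ w ∈ box (0 : Zd P.d) ℓ', |f w a b| := by
  rw [Finset.mul_sum]
  refine Finset.sum_le_sum fun a _ => ?_
  rw [Finset.mul_sum]
  refine Finset.sum_le_sum fun b _ => ?_
  rw [Finset.mul_sum]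
  refine Finset.sum_le_sum fun w hw => ?_
  refine mul_le_mul_of_nonneg_right ?_ (abs_nonneg _)
  rw [mem_box] at hw
  calc ∑ i, |((w i - (0 : Zd P.d) i : ℤ) : ℝ)| ≤ ∑ _i : Fin P.d, (ℓ' : ℝ) := Finset.sum_le_sum fun i _ => by
          have := hw i; rw [← Int.cast_abs]; exact_mod_cast this
    _ = (P.d : ℝ) * ℓ' := by simp

end Matched

/-! ## §4 The two-height pairing identity -/

/-- ★★ **THE TWO-HEIGHT PAIRING**: in the chart of the coarse corner `C`, for an antisymmetric torus reading `Φ` and `2L^h ≤ ℓ′`,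
`Σ_{w∈box 0 ℓ′} Σ_{ab} ω(w,a,b)·Φ(transl C w,a,b) = 2κ_j·[one-stroke of Φ at (y;μ,ν)] − ρ·2κ_h·[one-stroke of Φ at (Y;μ,ν)]`
(`κ_k = ((L^d)^k)⁻¹`; with ✓(M2) at both heights the brackets are `L^j(Q_jỸ)(∂p)` and `L^h(Q_hỸ)(∂P″)` read through `Φ`). [folklore] -/
theorem sum_matched_mul_eq (hj : j ≤ P.m + P.K) (hh : h ≤ P.m + P.K) (hjh : j ≤ h) {μ ν : Fin P.d} (hμν : μ ≠ ν)
    (y : Site P j) (Y : Site P h) (c C : Site P 0) (hc : ∀ i, (c i).val = (y i).val * P.L ^ j) (hC : ∀ i, (C i).val = (Y i).val * P.L ^ h)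
    (hnest : ∀ i, (y i).val / P.L ^ (h - j) = (Y i).val) (δ : Zd P.d)
    (hδ : ∀ i, δ i = ((y i).val : ℤ) * (P.L : ℤ) ^ j - ((Y i).val : ℤ) * (P.L : ℤ) ^ h) (ρ : ℝ)
    (ωj ωh ω : Zd P.d → Fin P.d → Fin P.d → ℝ)
    (hωj : ∀ w a b, ωj w a b = ((((P.L : ℝ) ^ P.d) ^ j)⁻¹ *
      ((((Finset.univ : Finset (Fin P.d → Fin (P.L ^ j))) ×ˢ (Finset.range (P.L ^ j) ×ˢ Finset.range (P.L ^ j))).filter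
        (fun τ => (fun i => ((τ.1 i : ℕ) : ℤ)) + (τ.2.1 : ℤ) • unitVec μ + (τ.2.2 : ℤ) • unitVec ν = w)).card : ℝ)) *
      ((if a = μ ∧ b = ν then 1 else 0) - (if a = ν ∧ b = μ then 1 else 0)))
    (hωh : ∀ w a b, ωh w a b = ((((P.L : ℝ) ^ P.d) ^ h)⁻¹ *
      ((((Finset.univ : Finset (Fin P.d → Fin (P.L ^ h))) ×ˢ (Finset.range (P.L ^ h) ×ˢ Finset.range (P.L ^ h))).filter
        (fun τ => (fun i => ((τ.1 i : ℕ) : ℤ)) + (τ.2.1 : ℤ) • unitVec μ + (τ.2.2 : ℤ) • unitVec ν = w)).card : ℝ)) *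
      ((if a = μ ∧ b = ν then 1 else 0) - (if a = ν ∧ b = μ then 1 else 0)))
    (hω : ∀ w a b, ω w a b = ωj (w - δ) a b - ρ * ωh w a b)
    (Φ : Site P 0 → Fin P.d → Fin P.d → ℝ) (hΦ : ∀ x a b, Φ x b a = -Φ x a b) {ℓ' : ℤ} (hℓ' : 2 * (P.L : ℤ) ^ h ≤ ℓ') :
    ∑ w ∈ box (0 : Zd P.d) ℓ', ∑ a, ∑ b, ω w a b * Φ (transl C w) a b
      = 2 * (((P.L : ℝ) ^ P.d) ^ j)⁻¹ *
          (∑ x ∈ iterBlock j y, ∑ s ∈ Finset.range (P.L ^ j), ∑ t ∈ Finset.range (P.L ^ j), Φ (runSite (runSite x μ s) ν t) μ ν)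
        - ρ * (2 * (((P.L : ℝ) ^ P.d) ^ h)⁻¹ *
          (∑ x ∈ iterBlock h Y, ∑ s ∈ Finset.range (P.L ^ h), ∑ t ∈ Finset.range (P.L ^ h), Φ (runSite (runSite x μ s) ν t) μ ν)) := by
  have hLj : (1 : ℤ) ≤ (P.L : ℤ) ^ j := by exact_mod_cast Nat.one_le_pow _ _ P.L_pos
  have hδ0 := fun i => (hδ i).symm ▸ offset_nonneg hjh y Y hnest i
  have hδ1 := fun i => (hδ i).symm ▸ offset_le hjh y Y hnest i
  have hLjh : (P.L : ℤ) ^ j ≤ (P.L : ℤ) ^ h := by exact_mod_cast Nat.pow_le_pow_right P.L_pos hjh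
  have hδℓ : ∀ i, |δ i| + 2 * (P.L : ℤ) ^ j ≤ ℓ' := fun i => by
    rw [abs_of_nonneg (hδ0 i)]; linarith [hδ1 i]
  -- split the matched charge
  have hsplit : ∑ w ∈ box (0 : Zd P.d) ℓ', ∑ a, ∑ b, ω w a b * Φ (transl C w) a b
      = (∑ w ∈ box (0 : Zd P.d) ℓ', ∑ a, ∑ b, ωj (w - δ) a b * Φ (transl C w) a b)
        - ρ * ∑ w ∈ box (0 : Zd P.d) ℓ', ∑ a, ∑ b, ωh w a b * Φ (transl C w) a b := by
    simp only [hω, sub_mul, Finset.sum_sub_distrib, mul_assoc, Finset.mul_sum]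
  rw [hsplit, sum_charge_mul_eq_oneStroke hh Y C hC hμν ωh hωh Φ hΦ hℓ']
  congr 1
  -- the fine charge: move the offset into the chart centre
  have hre : ∑ w ∈ box (0 : Zd P.d) ℓ', ∑ a, ∑ b, ωj (w - δ) a b * Φ (transl C w) a b
      = ∑ w ∈ box (0 : Zd P.d) (2 * (P.L : ℤ) ^ j), ∑ a, ∑ b, ωj w a b * Φ (transl c w) a b := by
    have hf : ∀ w, w ∉ box (0 : Zd P.d) (2 * (P.L : ℤ) ^ j) → (∑ a, ∑ b, ωj w a b * Φ (transl c w) a b) = 0 := by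
      intro w hw
      simp only [hωj, count_eq_zero_off_box hμν hw, Nat.cast_zero, mul_zero, zero_mul, Finset.sum_const_zero]
    rw [← sum_box_sub_offset_eq δ (fun w => ∑ a, ∑ b, ωj w a b * Φ (transl c w) a b) hf hδℓ]
    refine Finset.sum_congr rfl fun w _ => ?_
    rw [transl_offset_add y Y c C hc hC δ hδ (w - δ), add_sub_cancel]
  rw [hre, sum_charge_mul_eq_oneStroke hj y c hc hμν ωj hωj Φ hΦ le_rfl]


/-! ## §5 The three hypotheses of FILE 4∕5, inhabited by the counting charges -/

/-- ★★★ **THE MATCHED COUNTING CHARGE INHABITS FILE 4∕5's DATA**: with the counting charges of FILE 6 at heights `j ≤ h` and `ρ := (L^j)²∕(L^h)²`, the matched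
charge `ω` (i) vanishes off `box 0 (2L^h)`, (ii) is antisymmetric, (iii) has EVERY COMPONENT OF MEAN ZERO on `box 0 (2L^h)`, (iv) has ℓ¹ mass
`Σ_{ab}Σ_w|ω| ≤ 2(L^j)²·((L^d)^j)⁻¹(L^j)^d + 2ρ(L^h)²·((L^d)^h)⁻¹(L^h)^d` (`= 4L^{2j}` at face value), (v) height `|ω| ≤ ((L^d)^j)⁻¹(L^j)² + ρ((L^d)^h)⁻¹(L^h)²`. [folklore] -/
theorem matched_counting_data (hjh : j ≤ h) {μ ν : Fin P.d} (hμν : μ ≠ ν)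
    (y : Site P j) (Y : Site P h) (hnest : ∀ i, (y i).val / P.L ^ (h - j) = (Y i).val) (δ : Zd P.d)
    (hδ : ∀ i, δ i = ((y i).val : ℤ) * (P.L : ℤ) ^ j - ((Y i).val : ℤ) * (P.L : ℤ) ^ h)
    (ωj ωh ω : Zd P.d → Fin P.d → Fin P.d → ℝ)
    (hωj : ∀ w a b, ωj w a b = ((((P.L : ℝ) ^ P.d) ^ j)⁻¹ *
      ((((Finset.univ : Finset (Fin P.d → Fin (P.L ^ j))) ×ˢ (Finset.range (P.L ^ j) ×ˢ Finset.range (P.L ^ j))).filter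
        (fun τ => (fun i => ((τ.1 i : ℕ) : ℤ)) + (τ.2.1 : ℤ) • unitVec μ + (τ.2.2 : ℤ) • unitVec ν = w)).card : ℝ)) *
      ((if a = μ ∧ b = ν then 1 else 0) - (if a = ν ∧ b = μ then 1 else 0)))
    (hωh : ∀ w a b, ωh w a b = ((((P.L : ℝ) ^ P.d) ^ h)⁻¹ *
      ((((Finset.univ : Finset (Fin P.d → Fin (P.L ^ h))) ×ˢ (Finset.range (P.L ^ h) ×ˢ Finset.range (P.L ^ h))).filter
        (fun τ => (fun i => ((τ.1 i : ℕ) : ℤ)) + (τ.2.1 : ℤ) • unitVec μ + (τ.2.2 : ℤ) • unitVec ν = w)).card : ℝ)) *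
      ((if a = μ ∧ b = ν then 1 else 0) - (if a = ν ∧ b = μ then 1 else 0)))
    (hω : ∀ w a b, ω w a b = ωj (w - δ) a b - ((P.L : ℝ) ^ j) ^ 2 / ((P.L : ℝ) ^ h) ^ 2 * ωh w a b) :
    (∀ w, w ∉ box (0 : Zd P.d) (2 * (P.L : ℤ) ^ h) → ∀ a b, ω w a b = 0) ∧
    (∀ w a b, ω w b a = -ω w a b) ∧
    (∀ a b, ∑ w ∈ box (0 : Zd P.d) (2 * (P.L : ℤ) ^ h), ω w a b = 0) ∧
    (∑ a, ∑ b, ∑ w ∈ box (0 : Zd P.d) (2 * (P.L : ℤ) ^ h), |ω w a b|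
        ≤ 2 * (|(((P.L : ℝ) ^ P.d) ^ j)⁻¹| * (((P.L : ℝ) ^ j) ^ P.d * ((P.L : ℝ) ^ j * (P.L : ℝ) ^ j)))
          + 2 * (|((P.L : ℝ) ^ j) ^ 2 / ((P.L : ℝ) ^ h) ^ 2| * (|(((P.L : ℝ) ^ P.d) ^ h)⁻¹| * (((P.L : ℝ) ^ h) ^ P.d * ((P.L : ℝ) ^ h * (P.L : ℝ) ^ h))))) ∧
    (∀ w a b, |ω w a b| ≤ |(((P.L : ℝ) ^ P.d) ^ j)⁻¹| * ((P.L : ℝ) ^ j * (P.L : ℝ) ^ j)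
        + |((P.L : ℝ) ^ j) ^ 2 / ((P.L : ℝ) ^ h) ^ 2| * (|(((P.L : ℝ) ^ P.d) ^ h)⁻¹| * ((P.L : ℝ) ^ h * (P.L : ℝ) ^ h))) := by
  have hδ0 := fun i => (hδ i).symm ▸ offset_nonneg hjh y Y hnest i
  have hδ1 := fun i => (hδ i).symm ▸ offset_le hjh y Y hnest i
  have hNj := fun w (hw : w ∉ box (0 : Zd P.d) (2 * (P.L : ℤ) ^ j)) => count_eq_zero_off_box (k := j) hμν hw
  have hNh := fun w (hw : w ∉ box (0 : Zd P.d) (2 * (P.L : ℤ) ^ h)) => count_eq_zero_off_box (k := h) hμν hw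
  have hNj' : ∀ w, w ∉ box (0 : Zd P.d) (2 * (P.L : ℤ) ^ j) →
      ((((Finset.univ : Finset (Fin P.d → Fin (P.L ^ j))) ×ˢ (Finset.range (P.L ^ j) ×ˢ Finset.range (P.L ^ j))).filter
        (fun τ => (fun i => ((τ.1 i : ℕ) : ℤ)) + (τ.2.1 : ℤ) • unitVec μ + (τ.2.2 : ℤ) • unitVec ν = w)).card : ℝ) = 0 :=
    fun w hw => by rw [hNj w hw]; simp
  have hNh' : ∀ w, w ∉ box (0 : Zd P.d) (2 * (P.L : ℤ) ^ h) →
      ((((Finset.univ : Finset (Fin P.d → Fin (P.L ^ h))) ×ˢ (Finset.range (P.L ^ h) ×ˢ Finset.range (P.L ^ h))).filter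
        (fun τ => (fun i => ((τ.1 i : ℕ) : ℤ)) + (τ.2.1 : ℤ) • unitVec μ + (τ.2.2 : ℤ) • unitVec ν = w)).card : ℝ) = 0 :=
    fun w hw => by rw [hNh w hw]; simp
  have hTj := sum_count_eq (k := j) (μ := μ) (ν := ν) hμν (le_refl (2 * (P.L : ℤ) ^ j))
  have hTh := sum_count_eq (k := h) (μ := μ) (ν := ν) hμν (le_refl (2 * (P.L : ℤ) ^ h))
  have hL : (0 : ℝ) < P.L := by exact_mod_cast P.L_pos
  have hmatch : (((P.L : ℝ) ^ P.d) ^ j)⁻¹ * (((P.L : ℝ) ^ j) ^ P.d * ((P.L : ℝ) ^ j * (P.L : ℝ) ^ j))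
      = ((P.L : ℝ) ^ j) ^ 2 / ((P.L : ℝ) ^ h) ^ 2 * ((((P.L : ℝ) ^ P.d) ^ h)⁻¹ * (((P.L : ℝ) ^ h) ^ P.d * ((P.L : ℝ) ^ h * (P.L : ℝ) ^ h))) := by
    have e1 : ((P.L : ℝ) ^ P.d) ^ j = ((P.L : ℝ) ^ j) ^ P.d := by rw [← pow_mul, ← pow_mul, mul_comm]
    have e2 : ((P.L : ℝ) ^ P.d) ^ h = ((P.L : ℝ) ^ h) ^ P.d := by rw [← pow_mul, ← pow_mul, mul_comm]
    rw [e1, e2]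
    field_simp
  refine ⟨?_, ?_, ?_, ?_, ?_⟩
  · exact fun w hw a b => matched_eq_zero_off_box _ _ _ _ _ ωj ωh ω δ hjh hωj hωh hω hNj' hNh' hδ0 hδ1 w hw a b
  · exact fun w a b => matched_anti _ _ _ _ _ ωj ωh ω δ hωj hωh hω w a b
  · exact fun a b => sum_matched_eq_zero _ _ _ _ _ ωj ωh ω δ hjh hωj hωh hω hNj' hδ0 hδ1 hTj le_rfl hTh hmatch a b
  · exact sum_abs_matched_le _ _ _ _ _ ωj ωh ω δ hjh hωj hωh hω hμν hNj' (fun _ => Nat.cast_nonneg _) (fun _ => Nat.cast_nonneg _) hδ0 hδ1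
      hTj le_rfl hTh
  · intro w a b
    exact abs_matched_le _ _ _ _ _ ωj ωh ω δ hωj hωh hω (fun _ => Nat.cast_nonneg _) (fun _ => Nat.cast_nonneg _)
      (fun w => by exact_mod_cast count_le (μ := μ) (ν := ν) w) (fun w => by exact_mod_cast count_le (μ := μ) (ν := ν) w) w a b

end Summit.QuantumFields.YangMills.Theorems.CovariantDischargeMatchedPairCharge

end
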